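import Summits.AtomisticToContinuum.Crystallization.Theorems.FrustratedLawDichotomyStrainedPatchHomSplit

/-!
# The strained-patch piece `F1X∪T(0)`: the (H)/(R) split with a NARROWED homogeneous family (`‖G − 1‖ ≤ ρ_U`, `‖ξ‖ ≤ ρ_ξ`)

decomp-a2c hand-1 g45 (crux `AperiodicFrustratedLawGap`, stmt-AtomisticToContinuum-27623; `(H) HomFloor`, critic row 1481 (D) ①:
«a narrowed pair `HomFloorW ρ_U ρ_ξ m` / `TextureReliefBoundW ρ_U ρ_ξ L B` with the identical seam is one small Theorems file, NO Theses edit,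
target `StrainedPatchRec` unchanged ⇒ NOT a weakening of the line — IFF (R)'s refit lands inside the narrow family»).

`…StrainedPatchHomSplit` splits the piece as `HomFloor m ∧ TextureReliefBound L B ∧ L·σ₁ + B ≤ m ⟹ StrainedPatchRec` over the homogeneous family
`IsHomBall R` with the record radii `‖G − 1‖ ≤ 1/4`, `‖ξ‖ ≤ 1/4`.  The (H) certificate's cost is governed by that family's size (hand-1 g45 FINDING
«FORCE-PRUNE REACH MAP» §8–§10: the hcp shuffle is certified-convex only within `|ξ| ≲ 0.125` and no Taylor-type leaf of the potential reaches
U-boxes wider than `2⁻⁷` on the compressive far field).  This file types the same split over the family `IsHomBallW ρ_U ρ_ξ R` for ARBITRARY radii: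

* §1 `IsHomBallW`, its monotonicity in the radii, and `IsHomBall R z c ↔ IsHomBallW (1/4) (1/4) R z c`;
* §2 `HomFloorW ρ_U ρ_ξ m` (antitone in the floor, MONOTONE in shrinking the radii — a narrower family is a weaker demand) and
  `TextureReliefBoundW ρ_U ρ_ξ L B` (monotone in the allowance and in GROWING the radii), with the conversions to/from the record halves at `(1/4, 1/4)`;
* §3 ★ the seam `strainedPatchRec_of_homFloorW_of_reliefW : HomFloorW ρ_U ρ_ξ m → TextureReliefBoundW ρ_U ρ_ξ L B → L·σ₁ + B ≤ m → StrainedPatchRec`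
  for every `ρ_U ρ_ξ` (same three-line proof), its record-literal forms, and the necessity statements restricted to the narrow family.

Nothing landed is modified; `StrainedPatchRec` and the route's target are untouched; which radii (R) can deliver is lens-5's number (row 1481 (D) ①), not
asserted here.  0 sorry; standard axioms; no instances / notation / `#eval`.  `--supports stmt-AtomisticToContinuum-27623`.
-/

namespace Summit.AtomisticToContinuum.Crystallization.Theorems.FrustratedLawDichotomyStrainedPatchHomSplitNarrow

open scoped BigOperators Classical
open Summit.AtomisticToContinuum.Crystallization.Theorems.FrustratedLawDichotomyRangeCut
open Summit.AtomisticToContinuum.Crystallization.Theorems.FrustratedLawDichotomySchurCut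
open Summit.AtomisticToContinuum.Crystallization.Theorems.FrustratedLawDichotomyMotifLemmas
open Summit.AtomisticToContinuum.Crystallization.Theorems.FrustratedLawDichotomyAveragingCut
open Summit.AtomisticToContinuum.Crystallization.Theorems.FrustratedLawDichotomyAveragingRuleCap
open Summit.AtomisticToContinuum.Crystallization.Theorems.FrustratedLawDichotomyAveragingRuleTightFree
open Summit.AtomisticToContinuum.Crystallization.Theorems.FrustratedLawDichotomyExemptDoor (SitePred)
open Summit.AtomisticToContinuum.Crystallization.Theorems.FrustratedLawDichotomyExemptAbsorption
open Summit.AtomisticToContinuum.Crystallization.Theorems.FrustratedLawDichotomyExemptAbsorptionRecord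
open Summit.AtomisticToContinuum.Crystallization.Theorems.FrustratedLawDichotomyCollarCensus
open Summit.AtomisticToContinuum.Crystallization.Theorems.FrustratedLawDichotomyCollarCensusKappa
open Summit.AtomisticToContinuum.Crystallization.Theorems.FrustratedLawDichotomyStrainedPatchHomSplit

/-! ## §1. The homogeneous family with arbitrary radii -/

/-- **Homogeneous ball with radii `(ρ_U, ρ_ξ)`**: as `IsHomBall` (affinely deformed fcc lattice, or affinely deformed hcp structure with an internal
shuffle `ξ`) but with `‖G − 1‖ ≤ ρ_U` and `‖ξ‖ ≤ ρ_ξ` in place of the record `1/4`, `1/4`. [this file, hand-1 g45] -/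
def IsHomBallW (ρU ρξ R : ℝ) {M : ℕ} (z : Fin M → EuclideanSpace ℝ (Fin 3)) (c : Fin M) : Prop :=
  ∃ (G : EuclideanSpace ℝ (Fin 3) →L[ℝ] EuclideanSpace ℝ (Fin 3)) (ξ : EuclideanSpace ℝ (Fin 3)), ‖G - 1‖ ≤ ρU ∧ ‖ξ‖ ≤ ρξ ∧
    (Set.range z = {x | dist x (z c) ≤ R ∧ ∃ a : Fin 3 → ℤ, x = z c + latPt G Literature.Barriers.AtomisticToContinuum.FlatleyTheil2015.fccVec a} ∨
      Set.range z = {x | dist x (z c) ≤ R ∧ ∃ a : Fin 3 → ℤ, x = z c + latPt G hexFrame a ∨ x = z c + latPt G hexFrame a + G (hcpShift + ξ)})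

/-- The record family is the `(1/4, 1/4)` member. [formal bookkeeping] -/
theorem isHomBall_iff_isHomBallW {R : ℝ} {M : ℕ} {z : Fin M → EuclideanSpace ℝ (Fin 3)} {c : Fin M} :
    IsHomBall R z c ↔ IsHomBallW (1 / 4) (1 / 4) R z c :=
  Iff.rfl

/-- The family grows with the radii. [formal bookkeeping] -/
theorem IsHomBallW.mono {ρU ρξ ρU' ρξ' R : ℝ} {M : ℕ} {z : Fin M → EuclideanSpace ℝ (Fin 3)} {c : Fin M}
    (h : IsHomBallW ρU ρξ R z c) (hU : ρU ≤ ρU') (hξ : ρξ ≤ ρξ') : IsHomBallW ρU' ρξ' R z c := by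
  obtain ⟨G, ξ, hG, hx, hset⟩ := h
  exact ⟨G, ξ, hG.trans hU, hx.trans hξ, hset⟩

/-- A member of a narrow family (`ρ_U, ρ_ξ ≤ 1/4`) is a record homogeneous ball. [formal bookkeeping] -/
theorem isHomBall_of_isHomBallW {ρU ρξ R : ℝ} {M : ℕ} {z : Fin M → EuclideanSpace ℝ (Fin 3)} {c : Fin M}
    (h : IsHomBallW ρU ρξ R z c) (hU : ρU ≤ 1 / 4) (hξ : ρξ ≤ 1 / 4) : IsHomBall R z c :=
  isHomBall_iff_isHomBallW.2 (h.mono hU hξ)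

/-! ## §2. The two halves over the narrow family -/

/-- **(H_W) `HomFloorW ρ_U ρ_ξ m`** — the piece's ball average is `≥ m` on every ADMISSIBLE homogeneous instance of the `(ρ_U, ρ_ξ)` family.
[this file, hand-1 g45] -/
def HomFloorW (ρU ρξ m : ℝ) : Prop :=
  ∀ (M : ℕ) (z : Fin M → EuclideanSpace ℝ (Fin 3)) (c : Fin M), Admissible M z c → IsHomBallW ρU ρξ (133 / 10) z c →
    m ≤ ballAvg (9 / 5) z (xRec M z) c

/-- **(R_W) `TextureReliefBoundW ρ_U ρ_ξ L B`** — every admissible cluster is within `L·σ₁ + B` of SOME admissible homogeneous instance OF THE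
`(ρ_U, ρ_ξ)` FAMILY. [this file, hand-1 g45] -/
def TextureReliefBoundW (ρU ρξ L B : ℝ) : Prop :=
  ∀ (M : ℕ) (z : Fin M → EuclideanSpace ℝ (Fin 3)) (c : Fin M), Admissible M z c →
    ∃ (M₀ : ℕ) (z₀ : Fin M₀ → EuclideanSpace ℝ (Fin 3)) (c₀ : Fin M₀), Admissible M₀ z₀ c₀ ∧ IsHomBallW ρU ρξ (133 / 10) z₀ c₀ ∧
      ballAvg (9 / 5) z₀ (xRec M₀ z₀) c₀ - (L * sigmaOne + B) ≤ ballAvg (9 / 5) z (xRec M z) c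

/-- The record (H) is the `(1/4, 1/4)` member. [formal bookkeeping] -/
theorem homFloor_iff_homFloorW {m : ℝ} : HomFloor m ↔ HomFloorW (1 / 4) (1 / 4) m :=
  Iff.rfl

/-- The record (R) is the `(1/4, 1/4)` member. [formal bookkeeping] -/
theorem textureReliefBound_iff_textureReliefBoundW {L B : ℝ} : TextureReliefBound L B ↔ TextureReliefBoundW (1 / 4) (1 / 4) L B :=
  Iff.rfl

/-- ★ (H_W) gets EASIER as the family shrinks: `HomFloorW ρ_U ρ_ξ m → HomFloorW ρ_U' ρ_ξ' m` for `ρ_U' ≤ ρ_U`, `ρ_ξ' ≤ ρ_ξ`. [folklore] -/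
theorem HomFloorW.anti {ρU ρξ ρU' ρξ' m : ℝ} (h : HomFloorW ρU ρξ m) (hU : ρU' ≤ ρU) (hξ : ρξ' ≤ ρξ) : HomFloorW ρU' ρξ' m :=
  fun M z c hz hhom => h M z c hz (hhom.mono hU hξ)

/-- In particular the record (H) gives every narrow (H_W). [folklore] -/
theorem homFloorW_of_homFloor {ρU ρξ m : ℝ} (h : HomFloor m) (hU : ρU ≤ 1 / 4) (hξ : ρξ ≤ 1 / 4) : HomFloorW ρU ρξ m :=
  (homFloor_iff_homFloorW.1 h).anti hU hξ

/-- (H_W) is antitone in the floor. [folklore] -/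
theorem HomFloorW.mono {ρU ρξ m m' : ℝ} (h : HomFloorW ρU ρξ m) (hle : m' ≤ m) : HomFloorW ρU ρξ m' :=
  fun M z c hz hhom => hle.trans (h M z c hz hhom)

/-- ★ (R_W) gets HARDER as the family shrinks (and easier as it grows): `TextureReliefBoundW ρ_U ρ_ξ L B → TextureReliefBoundW ρ_U' ρ_ξ' L B` for
`ρ_U ≤ ρ_U'`, `ρ_ξ ≤ ρ_ξ'`. [folklore] -/
theorem TextureReliefBoundW.mono_radii {ρU ρξ ρU' ρξ' L B : ℝ} (h : TextureReliefBoundW ρU ρξ L B) (hU : ρU ≤ ρU') (hξ : ρξ ≤ ρξ') :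
    TextureReliefBoundW ρU' ρξ' L B := by
  intro M z c hz
  obtain ⟨M₀, z₀, c₀, h₀, hhom, hle⟩ := h M z c hz
  exact ⟨M₀, z₀, c₀, h₀, hhom.mono hU hξ, hle⟩

/-- In particular a narrow (R_W) gives the record (R). [folklore] -/
theorem textureReliefBound_of_textureReliefBoundW {ρU ρξ L B : ℝ} (h : TextureReliefBoundW ρU ρξ L B) (hU : ρU ≤ 1 / 4) (hξ : ρξ ≤ 1 / 4) :
    TextureReliefBound L B :=
  textureReliefBound_iff_textureReliefBoundW.2 (h.mono_radii hU hξ)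

/-- (R_W) is monotone in the allowance. [folklore] -/
theorem TextureReliefBoundW.mono {ρU ρξ L B L' B' : ℝ} (h : TextureReliefBoundW ρU ρξ L B) (hle : L * sigmaOne + B ≤ L' * sigmaOne + B') :
    TextureReliefBoundW ρU ρξ L' B' := by
  intro M z c hz
  obtain ⟨M₀, z₀, c₀, h₀, hhom, hval⟩ := h M z c hz
  exact ⟨M₀, z₀, c₀, h₀, hhom, by linarith⟩

/-! ## §3. The seam over the narrow family, record literals, necessity -/

/-- ★ **SEAM (narrow family)**: `HomFloorW ρ_U ρ_ξ m ∧ TextureReliefBoundW ρ_U ρ_ξ L B ∧ L·σ₁ + B ≤ m ⟹ F1X∪T(0)` — for EVERY pair of radii; the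
narrowing is paid for entirely on the (R) side. [folklore: three lines] -/
theorem strainedPatchRec_of_homFloorW_of_reliefW {ρU ρξ m L B : ℝ} (hH : HomFloorW ρU ρξ m) (hR : TextureReliefBoundW ρU ρξ L B)
    (hm : L * sigmaOne + B ≤ m) : StrainedPatchRec := by
  intro M z c hz
  obtain ⟨M₀, z₀, c₀, h₀, hhom, hle⟩ := hR M z c hz
  have hfloor := hH M₀ z₀ c₀ h₀ hhom
  linarith

/-- ★ **SEAM, record form** (the `h1` hypothesis of `…ZeroFree.…_unionT_zero_free`) from the two narrow halves. [folklore] -/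
theorem strainedPatch_of_homFloorW_of_reliefW {ρU ρξ m L B : ℝ} (hH : HomFloorW ρU ρξ m) (hR : TextureReliefBoundW ρU ρξ L B)
    (hm : L * sigmaOne + B ≤ m) :
    StrainedPatchMotifPricingCapXK (1 / 1000) (9 / 5) (133 / 10) (3 / 2) (effPot w₄₅ ω₄ (3 / 400)) (-(7175 / 10000) + 3 / 400)
      (Collar (9 / 2) fun N y j => (∃ s : ℝ, 0 ≤ s ∧ s ≤ 3 / 2 ∧ NonEquilibriumCore (-(7175 / 10000)) 0 7 s (1 / 10000) N y j) ∨
        GoodAtScale (1 / 20) (3 / 2) y j) :=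
  strainedPatch_iff.1 (strainedPatchRec_of_homFloorW_of_reliefW hH hR hm)

/-- ★★ **THE NODE with the record literals over a narrow family**: `HomFloorW ρ_U ρ_ξ (1/625) ∧ TextureReliefBoundW ρ_U ρ_ξ (1/12) (1/4000) ⟹ F1X∪T(0)`
(seam arithmetic `seam_arith` of `…HomSplit`). -/
theorem strainedPatch_of_homFloorW_625_of_reliefW {ρU ρξ : ℝ} (hH : HomFloorW ρU ρξ (1 / 625))
    (hR : TextureReliefBoundW ρU ρξ (1 / 12) (1 / 4000)) :
    StrainedPatchMotifPricingCapXK (1 / 1000) (9 / 5) (133 / 10) (3 / 2) (effPot w₄₅ ω₄ (3 / 400)) (-(7175 / 10000) + 3 / 400)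
      (Collar (9 / 2) fun N y j => (∃ s : ℝ, 0 ≤ s ∧ s ≤ 3 / 2 ∧ NonEquilibriumCore (-(7175 / 10000)) 0 7 s (1 / 10000) N y j) ∨
        GoodAtScale (1 / 20) (3 / 2) y j) :=
  strainedPatch_of_homFloorW_of_reliefW hH hR seam_arith

/-- The milli variant over a narrow family: `HomFloorW ρ_U ρ_ξ (1/1000) ∧ TextureReliefBoundW ρ_U ρ_ξ (1/16) (1/4000) ⟹ F1X∪T(0)`. -/
theorem strainedPatch_of_homFloorW_milli_of_reliefW {ρU ρξ : ℝ} (hH : HomFloorW ρU ρξ (1 / 1000))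
    (hR : TextureReliefBoundW ρU ρξ (1 / 16) (1 / 4000)) :
    StrainedPatchMotifPricingCapXK (1 / 1000) (9 / 5) (133 / 10) (3 / 2) (effPot w₄₅ ω₄ (3 / 400)) (-(7175 / 10000) + 3 / 400)
      (Collar (9 / 2) fun N y j => (∃ s : ℝ, 0 ≤ s ∧ s ≤ 3 / 2 ∧ NonEquilibriumCore (-(7175 / 10000)) 0 7 s (1 / 10000) N y j) ∨
        GoodAtScale (1 / 20) (3 / 2) y j) :=
  strainedPatch_of_homFloorW_of_reliefW hH hR seam_arith_milli

/-- ★ The (I3) instance of row 1481 (D) ①: `HomFloorW (1/8) (1/16) (1/625) ∧ TextureReliefBoundW (1/8) (1/16) (1/12) (1/4000) ⟹ F1X∪T(0)`. -/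
theorem strainedPatch_of_homFloorW_eighth_sixteenth (hH : HomFloorW (1 / 8) (1 / 16) (1 / 625))
    (hR : TextureReliefBoundW (1 / 8) (1 / 16) (1 / 12) (1 / 4000)) :
    StrainedPatchMotifPricingCapXK (1 / 1000) (9 / 5) (133 / 10) (3 / 2) (effPot w₄₅ ω₄ (3 / 400)) (-(7175 / 10000) + 3 / 400)
      (Collar (9 / 2) fun N y j => (∃ s : ℝ, 0 ≤ s ∧ s ≤ 3 / 2 ∧ NonEquilibriumCore (-(7175 / 10000)) 0 7 s (1 / 10000) N y j) ∨
        GoodAtScale (1 / 20) (3 / 2) y j) :=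
  strainedPatch_of_homFloorW_625_of_reliefW hH hR

/-- **NECESSITY of (H_W) at level 0** for every family inside the record one: the piece restricted to narrow homogeneous instances. [folklore] -/
theorem homFloorW_zero_of_strainedPatchRec {ρU ρξ : ℝ} (h : StrainedPatchRec) : HomFloorW ρU ρξ 0 :=
  fun M z c hz _ => h M z c hz

/-- **Where (R_W) sits**: the piece together with ONE admissible homogeneous instance OF THE NARROW FAMILY of value `≤ L·σ₁ + B` gives
`TextureReliefBoundW ρ_U ρ_ξ L B`. [folklore] -/
theorem reliefW_of_strainedPatchRec_of_witness {ρU ρξ L B : ℝ} (h : StrainedPatchRec) {M₀ : ℕ} {z₀ : Fin M₀ → EuclideanSpace ℝ (Fin 3)} {c₀ : Fin M₀}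
    (h₀ : Admissible M₀ z₀ c₀) (hhom : IsHomBallW ρU ρξ (133 / 10) z₀ c₀) (hval : ballAvg (9 / 5) z₀ (xRec M₀ z₀) c₀ ≤ L * sigmaOne + B) :
    TextureReliefBoundW ρU ρξ L B :=
  fun M z c hz => ⟨M₀, z₀, c₀, h₀, hhom, by have := h M z c hz; linarith⟩

/-- ★ **TRANSFER OF A LANDED (H) TO A NARROW SEAM**: if the record `HomFloor m` is certified, any narrow (R_W) with allowance `≤ m` closes the piece —
so narrowing (R)'s target family never invalidates (H) work already landed. [folklore] -/
theorem strainedPatchRec_of_homFloor_of_reliefW {ρU ρξ m L B : ℝ} (hH : HomFloor m) (hU : ρU ≤ 1 / 4) (hξ : ρξ ≤ 1 / 4)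
    (hR : TextureReliefBoundW ρU ρξ L B) (hm : L * sigmaOne + B ≤ m) : StrainedPatchRec :=
  strainedPatchRec_of_homFloorW_of_reliefW (homFloorW_of_homFloor hH hU hξ) hR hm

end Summit.AtomisticToContinuum.Crystallization.Theorems.FrustratedLawDichotomyStrainedPatchHomSplitNarrow
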